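import Summits.QuantumFields.BalabanUV.Beta.D1BFx.GhostRowBookkeeping
import Summits.QuantumFields.BalabanUV.Beta.D1BFx.GhostCompositeLegProfiles

/-!
# `BalabanUV.Beta.D1BFx.RestKernelGhostSharpLegs` — road «BF-x» for binder row D1, slot (K), GHOST-N8-SPEC v0.2 §3″ FILE F5 PART 3a «THE LEG TABLE AT ONE SCALE»
# for the sharp rows (PART 3b `RestKernelGhostSharpRows`): the value ∕ right-difference letters of the six ghost legs `G`, `P`, `P∘G`, `G∘P`, `G∘(P∘G)`,
# `G∘G` at one scale `n = L^k`, common rate `δ₀∕4`, every constant in the `c∕n^e` form the row bookkeeping (PART 2) reads, plus the fibre∕rate plumbing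

HONEST DEPENDENCY (cell records, verbatim): «continuum YM on T⁴ ⇐ BetaPertH ∧ nine spine estimates (0/9 proved); BetaPertH ⇐ (D1) ∧ (D4) ∧
CAP+tail; G-an2-4 gates asym, D1 and NE2/3/4.»  HONEST FRAMING (cell contract, verbatim): «discharging `BetaPertH` makes Bałaban's UV stability
UNCONDITIONAL — a real constructive-QFT result; it is NOT the continuum limit and NOT the Clay problem.»  THIS MODULE DISCHARGES NOTHING of the
wall: [folklore] composition BY NAME of this seat's F5 PARTS 1–2 (`GhostRoadWordLetters`, `GhostRowBookkeeping`), F3 (`GhostLegProfilesRight`: β2 and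
`ProjectorSupNorm` in the profile currency; `GhostCompositeLegProfiles` over gaps-g1-p1's `ProfileLegComposition`), leaf-01's `RestKernelGhostWords.ghostWordK`
and the typer's `RestKernelGhostUnit.abs_secondMoment_le`.  The INPUT LAW is β2 (`GhostLegProfile.exists_Ggh_profile`, scales `n = L^k`, `L ≥ 2`) — hence the
rows are stated on those scales only.  No definition, no `def … : Prop`, nothing cited, 0 sorry.  0 root-level binders of row D1 discharged (hW ∕ hR-sockets ∕
hSX-socket ∕ D1Tel ∕ D1Rep = 0); (K) NOT closed (the END consumes these rows under the OWNER's ρ-g20-2 ∕ an2's R-D1-g45-4 architecture, not here); NOT D1,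
NOT `BetaPertH`, NOT continuum, NOT Clay.

ABSOLUTE RULE (cell charter, verbatim): «No internally-minted statement may enter as a cited fact. Every hypothesis is either kernel-proved in
this package or a verbatim quotation of a PUBLISHED theorem with page reference. The manuscript(s) under audit are NOT citable for their own
disputed steps — they are the thing under adjudication; programme-internal (2001/route/tribunal) claims are never citable.»

CONTENT ([folklore]; `L ≥ 2`, `0 < a`; common rate `δ₀ := min δ_β2 (deltaPP 4 a)`).
* §0 plumbing (`unit_lift`, `weaken_letter`, `le_const_of_flat`, `reassoc`, `one_le_of_scale`).
* §1 **`legs`**: given β2's `(δ, C)` in the profile currency (`GhostLegProfilesRight.ggh_profiles`) and a scale `m + 1 = L^k`, the twelve letters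
  (value ∕ right difference of `Ggh`, `Pgt`, `Pgt∘Ggh`, `Ggh∘Pgt`, `Ggh∘(Pgt∘Ggh)`, `Ggh∘Ggh`) at rate `δ₀∕4` with constants `C∕n²`, `C∕n²`, `cP∕n⁴`, `cP∕n⁵`,
  `cP·C·B₂∕n⁴`, `cP·C·B₃∕n⁵`, `C·cP·B₂∕n⁴`, `C·cP·B₂∕n⁵`, `C·(cP·C·B₂)·B₂′∕n⁴`, `C·(cP·C·B₃)·B₂′∕n⁵`, `C·C·(1+2∕δ₀)·C₄∕n³` (exponent 1), `C·C·C₄∕n⁴` (exponent 1)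
  — `cP := cPPs 4 a·e^{δ_PP}`, `B₂, B₃, B₂′ = B₂(δ₀∕2)`, `C₄ = 373248` from F3 PART 2.
NOT HERE (honest): the rows (PART 3b); anything of the END.
Unit `b2b-balaban-beta-d1-formalise-leaf-04` (gen 26), D1 formalisation swarm, road «BF-x»; INTENT-8 [D1LEAF04-G26-INTENT-8]. Not in print; no existing file touched.
-/

noncomputable section

namespace Summit.QuantumFields.BalabanUV.Beta.D1BFx.RestKernelGhostSharpLegs

open scoped BigOperators
open Finset
open Literature.MathematicalPhysics.QuantumFieldTheory.Balaban1983to89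
open Literature.MathematicalPhysics.QuantumFieldTheory.Balaban1983to89.Beta
open B12Sec2to5 (l1 Decay510)
open ExpKernelCalculus (Site MKer comp tr tadpole decay510_mono_const)
open AffineAveraging (unitVec)
open PoissonInterior (supNorm nrm nrm_pos one_le_nrm)
open Summit.QuantumFields.BalabanUV.Beta.D1BFx.PackedKernelSplit (biBubble)
open Summit.QuantumFields.BalabanUV.Beta.D1BFx.GhostStencil (ghCur)
open Summit.QuantumFields.BalabanUV.Beta.D1BFx.TorusGhostPairStencils (gh₂)
open Summit.QuantumFields.BalabanUV.Beta.D1BFx.ReducedKernelF (vertexRedF)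
open Summit.QuantumFields.BalabanUV.Beta.D1BFx.ReducedTableF (tableRedF)
open Summit.QuantumFields.BalabanUV.Beta.D1BFx.GhostLeg (Ggh)
open Summit.QuantumFields.BalabanUV.Beta.D1BFx.RProjector (Pgt deltaPP deltaPP_pos)
open Summit.QuantumFields.BalabanUV.Beta.D1BFx.ProjectorSupNorm (cPPs cPPs_nonneg)
open Summit.QuantumFields.BalabanUV.Beta.D1BFx.RestKernelGhostWords (GhIdx ghostWord ghostWordK pairLegL pairLegR)
open Summit.QuantumFields.BalabanUV.Beta.D1BFx.RestKernelGhostUnit (abs_secondMoment_le momentSum_nonneg)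
open Summit.QuantumFields.BalabanUV.Beta.D1BFx.GhostLegProfilesRight (ggh_profiles abs_Pgt_le_profile abs_Pgt_diff_right_le_profile exp_rate_mono)
open Summit.QuantumFields.BalabanUV.Beta.D1BFx.GhostCompositeLegProfiles (flat_of_profile_zero abs_comp_SG_le abs_comp_SG_diff_right_le abs_comp_GS_le
  abs_comp_GS_diff_right_le abs_comp_GSG_le abs_comp_GSG_diff_right_le abs_comp_GG_le abs_comp_GG_diff_right_le)
open Summit.QuantumFields.BalabanUV.Beta.D1BFx.GhostRowBookkeeping (decay510_road_biBubble_pow_neg_half decay510_road_biBubble_pow_half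
  decay510_road_tadpole_pow_half)

/-! ## §0 Plumbing -/

/-- [folklore] A `Unit`-fibred letter stated at `() ()` holds at all fibre indices. -/
theorem unit_lift {K : MKer 4 Unit} {B : Site 4 → Site 4 → ℝ} (h : ∀ x y, |K x y () ()| ≤ B x y) : ∀ x y (g f : Unit), |K x y g f| ≤ B x y := by
  intro x y g f; obtain ⟨⟩ := g; obtain ⟨⟩ := f; exact h x y

/-- [folklore] Weakening the rate of a profile letter (`0 ≤ δ′ ≤ δ`, `n ≥ 1`, `κ ≥ 0`), pointwise form. -/
theorem weaken_letter {n : ℕ} (hn : 1 ≤ n) {κ δ δ' t : ℝ} {p : ℕ} (hκ : 0 ≤ κ) (hle : δ' ≤ δ) (z : Site 4)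
    (h : t ≤ κ / nrm z ^ p * Real.exp (-(δ / n) * supNorm z)) : t ≤ κ / nrm z ^ p * Real.exp (-(δ' / n) * supNorm z) :=
  h.trans (mul_le_mul_of_nonneg_left (exp_rate_mono hn hle z) (by have := nrm_pos z; positivity))

/-- [folklore] A flat letter bounds the leg by its constant: `|K x y| ≤ κ∕nrm^0·e^{−c·s} ≤ κ` (`0 ≤ κ`, `0 ≤ c`). -/
theorem le_const_of_flat {n : ℕ} {K : MKer 4 Unit} {κ δ : ℝ} (hκ : 0 ≤ κ) (hδ : 0 ≤ δ)
    (h : ∀ x y (g f : Unit), |K x y g f| ≤ κ / nrm (x - y) ^ 0 * Real.exp (-(δ / n) * supNorm (x - y))) : ∀ x y (g f : Unit), |K x y g f| ≤ κ := by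
  intro x y g f
  refine (h x y g f).trans ?_
  rw [pow_zero, div_one]
  refine mul_le_of_le_one_right hκ (Real.exp_le_one_iff.2 ?_)
  have : (0 : ℝ) ≤ supNorm (x - y) := Nat.cast_nonneg _
  have : 0 ≤ δ / n := div_nonneg hδ (Nat.cast_nonneg _)
  nlinarith

/-- [folklore] Reassociation used to read a bound `a·(b·c)·d` as `(a·b·d)·c`. -/
theorem reassoc (a b c d : ℝ) : a * (b * c) * d = a * b * d * c := by ring

/-! ## §1 The leg table at one scale -/

section Rows

variable {L : ℕ} (hL : 2 ≤ L) {a : ℝ} (ha : 0 < a)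
include hL ha

/-- [folklore] **THE SCALE FACTS**: for `n = m + 1 = L^k`, `1 ≤ n` and `(n : ℝ) ≥ 1`. -/
theorem one_le_of_scale {k m : ℕ} (hk : 1 ≤ k) (hm : m + 1 = L ^ k) : 1 ≤ m + 1 ∧ (1 : ℝ) ≤ ((m + 1 : ℕ) : ℝ) := by
  have _ := hk; have _ := hm; have _ := hL; have _ := ha
  exact ⟨Nat.le_add_left 1 m, by exact_mod_cast Nat.le_add_left 1 m⟩

/-- [folklore] **THE LEG TABLE AT ONE SCALE** ((O5) instantiated; every letter at the common rate `δ₀∕4`, every constant in the `c∕n^e` form F5 PART 2 reads):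
value ∕ right-difference letters of `G`, `P`, `P∘G`, `G∘P`, `G∘(P∘G)`, `G∘G` with their `c ≤`-bounds. -/
theorem legs {δβ C : ℝ} (hδβ : 0 < δβ) (hC : 0 < C)
    (hG : ∀ (k : ℕ), 1 ≤ k → ∀ (n : ℕ) [NeZero n], n = L ^ k → ∀ δ' : ℝ, 0 ≤ δ' → δ' ≤ δβ →
      (∀ x y : Site 4, |Ggh n a x y () ()| ≤ (C / (n : ℝ) ^ 2) / nrm (x - y) ^ 2 * Real.exp (-(δ' / n) * supNorm (x - y))) ∧
      (∀ (x y : Site 4) (μ : Fin 4), |Ggh n a (x + unitVec μ) y () () - Ggh n a x y () ()|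
          ≤ (C / (n : ℝ) ^ 2) / nrm (x - y) ^ 3 * Real.exp (-(δ' / n) * supNorm (x - y))) ∧
      (∀ (x y : Site 4) (μ : Fin 4), |Ggh n a x (y + unitVec μ) () () - Ggh n a x y () ()|
          ≤ (C / (n : ℝ) ^ 2) / nrm (x - y) ^ 3 * Real.exp (-(δ' / n) * supNorm (x - y))))
    {k m : ℕ} (hk : 1 ≤ k) (hm : m + 1 = L ^ k) :
    let δ₀ : ℝ := min δβ (deltaPP 4 a)
    (∀ x y, |Ggh (m + 1) a x y () ()| ≤ (C / (((m + 1 : ℕ) : ℝ)) ^ 2) / nrm (x - y) ^ 2 * Real.exp (-(δ₀ / 4 / ((m + 1 : ℕ) : ℝ)) * supNorm (x - y))) ∧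
    (∀ x y (μ : Fin 4), |Ggh (m + 1) a x (y + unitVec μ) () () - Ggh (m + 1) a x y () ()| ≤ (C / (((m + 1 : ℕ) : ℝ)) ^ 2) / nrm (x - y) ^ 3 * Real.exp (-(δ₀ / 4 / ((m + 1 : ℕ) : ℝ)) * supNorm (x - y))) ∧
    (∀ x y, |Pgt (m + 1) a x y () ()| ≤ ((cPPs 4 a * Real.exp (deltaPP 4 a)) / (((m + 1 : ℕ) : ℝ)) ^ 4) / nrm (x - y) ^ 0 * Real.exp (-(δ₀ / 4 / ((m + 1 : ℕ) : ℝ)) * supNorm (x - y))) ∧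
    (∀ x y (μ : Fin 4), |Pgt (m + 1) a x (y + unitVec μ) () () - Pgt (m + 1) a x y () ()| ≤ ((cPPs 4 a * Real.exp (deltaPP 4 a)) / (((m + 1 : ℕ) : ℝ)) ^ 5) / nrm (x - y) ^ 0 * Real.exp (-(δ₀ / 4 / ((m + 1 : ℕ) : ℝ)) * supNorm (x - y))) ∧
    (∀ x y, |comp (Pgt (m + 1) a) (Ggh (m + 1) a) x y () ()| ≤ ((cPPs 4 a * Real.exp (deltaPP 4 a)) * C * (1 + 216 * (4 / δ₀ * (1 + 4 / δ₀))) / (((m + 1 : ℕ) : ℝ)) ^ 4) / nrm (x - y) ^ 0 * Real.exp (-(δ₀ / 4 / ((m + 1 : ℕ) : ℝ)) * supNorm (x - y))) ∧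
    (∀ x y (μ : Fin 4), |comp (Pgt (m + 1) a) (Ggh (m + 1) a) x (y + unitVec μ) () () - comp (Pgt (m + 1) a) (Ggh (m + 1) a) x y () ()|
        ≤ ((cPPs 4 a * Real.exp (deltaPP 4 a)) * C * (1 + 216 * (1 + 4 / δ₀)) / (((m + 1 : ℕ) : ℝ)) ^ 5) / nrm (x - y) ^ 0 * Real.exp (-(δ₀ / 4 / ((m + 1 : ℕ) : ℝ)) * supNorm (x - y))) ∧
    (∀ x y, |comp (Ggh (m + 1) a) (Pgt (m + 1) a) x y () ()| ≤ (C * (cPPs 4 a * Real.exp (deltaPP 4 a)) * (1 + 216 * (4 / δ₀ * (1 + 4 / δ₀))) / (((m + 1 : ℕ) : ℝ)) ^ 4) / nrm (x - y) ^ 0 * Real.exp (-(δ₀ / 4 / ((m + 1 : ℕ) : ℝ)) * supNorm (x - y))) ∧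
    (∀ x y (μ : Fin 4), |comp (Ggh (m + 1) a) (Pgt (m + 1) a) x (y + unitVec μ) () () - comp (Ggh (m + 1) a) (Pgt (m + 1) a) x y () ()|
        ≤ (C * (cPPs 4 a * Real.exp (deltaPP 4 a)) * (1 + 216 * (4 / δ₀ * (1 + 4 / δ₀))) / (((m + 1 : ℕ) : ℝ)) ^ 5) / nrm (x - y) ^ 0 * Real.exp (-(δ₀ / 4 / ((m + 1 : ℕ) : ℝ)) * supNorm (x - y))) ∧
    (∀ x y, |comp (Ggh (m + 1) a) (comp (Pgt (m + 1) a) (Ggh (m + 1) a)) x y () ()| ≤ (C * ((cPPs 4 a * Real.exp (deltaPP 4 a)) * C * (1 + 216 * (4 / δ₀ * (1 + 4 / δ₀)))) * (1 + 216 * (4 / (δ₀ / 2) * (1 + 4 / (δ₀ / 2)))) / (((m + 1 : ℕ) : ℝ)) ^ 4) / nrm (x - y) ^ 0 * Real.exp (-(δ₀ / 4 / ((m + 1 : ℕ) : ℝ)) * supNorm (x - y))) ∧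
    (∀ x y (μ : Fin 4), |comp (Ggh (m + 1) a) (comp (Pgt (m + 1) a) (Ggh (m + 1) a)) x (y + unitVec μ) () ()
        - comp (Ggh (m + 1) a) (comp (Pgt (m + 1) a) (Ggh (m + 1) a)) x y () ()| ≤ (C * ((cPPs 4 a * Real.exp (deltaPP 4 a)) * C * (1 + 216 * (1 + 4 / δ₀))) * (1 + 216 * (4 / (δ₀ / 2) * (1 + 4 / (δ₀ / 2)))) / (((m + 1 : ℕ) : ℝ)) ^ 5) / nrm (x - y) ^ 0 * Real.exp (-(δ₀ / 4 / ((m + 1 : ℕ) : ℝ)) * supNorm (x - y))) ∧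
    (∀ x y, |comp (Ggh (m + 1) a) (Ggh (m + 1) a) x y () ()| ≤ (C * C * (1 + 2 / δ₀) * 373248 / (((m + 1 : ℕ) : ℝ)) ^ 3) / nrm (x - y) ^ 1 * Real.exp (-(δ₀ / 4 / ((m + 1 : ℕ) : ℝ)) * supNorm (x - y))) ∧
    (∀ x y (μ : Fin 4), |comp (Ggh (m + 1) a) (Ggh (m + 1) a) x (y + unitVec μ) () () - comp (Ggh (m + 1) a) (Ggh (m + 1) a) x y () ()|
        ≤ (C * C * 373248 / (((m + 1 : ℕ) : ℝ)) ^ 4) / nrm (x - y) ^ 1 * Real.exp (-(δ₀ / 4 / ((m + 1 : ℕ) : ℝ)) * supNorm (x - y))) := by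
  intro δ₀
  have hPP := deltaPP_pos 4 ha
  have hδ₀0 : 0 < δ₀ := lt_min hδβ hPP
  have hδ₀β : δ₀ ≤ δβ := min_le_left _ _
  have hδ₀P : δ₀ ≤ deltaPP 4 a := min_le_right _ _
  have h4β : δ₀ / 4 ≤ δβ := by linarith
  have h4P : δ₀ / 4 ≤ deltaPP 4 a := by linarith
  have h40 : 0 ≤ δ₀ / 4 := by linarith
  have h42 : δ₀ / 4 ≤ δ₀ / 2 := by linarith
  have h41 : δ₀ / 4 ≤ δ₀ := by linarith
  obtain ⟨hn, hN⟩ := one_le_of_scale hL ha hk hm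
  have hN0 : (0 : ℝ) < ((m + 1 : ℕ) : ℝ) := by linarith
  -- elementary letters at `δ₀` (for the composites) and at `δ₀∕4`
  obtain ⟨hG0, -, hG2⟩ := hG k hk (m + 1) hm δ₀ hδ₀0.le hδ₀β
  obtain ⟨hG0q, -, hG2q⟩ := hG k hk (m + 1) hm (δ₀ / 4) h40 h4β
  have hS0 := flat_of_profile_zero (fun x y (g f : Unit) => abs_Pgt_le_profile (m + 1) ha hδ₀0.le hδ₀P x y g f)
  have hS2 : ∀ x y (μ : Fin 4) (g f : Unit), |Pgt (m + 1) a x (y + unitVec μ) g f - Pgt (m + 1) a x y g f|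
      ≤ ((cPPs 4 a * Real.exp (deltaPP 4 a)) / (((m + 1 : ℕ) : ℝ)) ^ 5) * Real.exp (-(δ₀ / ((m + 1 : ℕ) : ℝ)) * supNorm (x - y)) := by
    intro x y μ g f; have := abs_Pgt_diff_right_le_profile (m + 1) ha hδ₀0.le hδ₀P x y μ g f; rwa [pow_zero, div_one] at this
  have hκS : 0 ≤ (cPPs 4 a * Real.exp (deltaPP 4 a)) / (((m + 1 : ℕ) : ℝ)) ^ 4 := by have := cPPs_nonneg 4 ha; positivity
  have hκS' : 0 ≤ (cPPs 4 a * Real.exp (deltaPP 4 a)) / (((m + 1 : ℕ) : ℝ)) ^ 5 := by have := cPPs_nonneg 4 ha; positivity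
  have hκG : 0 ≤ C / (((m + 1 : ℕ) : ℝ)) ^ 2 := by positivity
  have hG0u := unit_lift hG0
  have hG2u : ∀ x y (μ : Fin 4) (g f : Unit), |Ggh (m + 1) a x (y + unitVec μ) g f - Ggh (m + 1) a x y g f|
      ≤ C / (((m + 1 : ℕ) : ℝ)) ^ 2 / nrm (x - y) ^ 3 * Real.exp (-(δ₀ / ((m + 1 : ℕ) : ℝ)) * supNorm (x - y)) := by
    intro x y μ g f; obtain ⟨⟩ := g; obtain ⟨⟩ := f; exact hG2 x y μ
  -- the composites (gaps' (C1)∕(C2)∕(C3)∕(C4) through F3 PART 2), then weakened to `δ₀∕4`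
  have cSG := abs_comp_SG_le hn hκS hκG hδ₀0 hS0 hG0u
  have cSGd := abs_comp_SG_diff_right_le hn hκS hκG hκG hδ₀0 hS0 hG0u hG2u
  have cGS := abs_comp_GS_le hn hκS hκG hδ₀0 hS0 hG0u
  have cGSd := abs_comp_GS_diff_right_le hn hκS hκS' hκG hδ₀0 hS0 hS2 hG0u
  have cGSG := abs_comp_GSG_le hn hκS hκG hδ₀0 hS0 hG0u
  have cGSGd := abs_comp_GSG_diff_right_le hn hκS hκG hκG hδ₀0 hS0 hG0u hG2u
  have cGG := abs_comp_GG_le hn hκG hδ₀0 hG0u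
  have cGGd := abs_comp_GG_diff_right_le hn hκG hκG hδ₀0 hG0u hG2u
  have pSG : 0 ≤ (cPPs 4 a * Real.exp (deltaPP 4 a)) / (((m + 1 : ℕ) : ℝ)) ^ 4 * (C / (((m + 1 : ℕ) : ℝ)) ^ 2) * (1 + 216 * (4 / δ₀ * (1 + 4 / δ₀))) * (((m + 1 : ℕ) : ℝ)) ^ 2 := by positivity
  have pSGd : 0 ≤ (cPPs 4 a * Real.exp (deltaPP 4 a)) / (((m + 1 : ℕ) : ℝ)) ^ 4 * (C / (((m + 1 : ℕ) : ℝ)) ^ 2) * (1 + 216 * (1 + 4 / δ₀)) * (((m + 1 : ℕ) : ℝ)) ^ 1 := by positivity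
  have pGS : 0 ≤ C / (((m + 1 : ℕ) : ℝ)) ^ 2 * ((cPPs 4 a * Real.exp (deltaPP 4 a)) / (((m + 1 : ℕ) : ℝ)) ^ 4) * (1 + 216 * (4 / δ₀ * (1 + 4 / δ₀))) * (((m + 1 : ℕ) : ℝ)) ^ 2 := by positivity
  have pGSd : 0 ≤ C / (((m + 1 : ℕ) : ℝ)) ^ 2 * ((cPPs 4 a * Real.exp (deltaPP 4 a)) / (((m + 1 : ℕ) : ℝ)) ^ 5) * (1 + 216 * (4 / δ₀ * (1 + 4 / δ₀))) * (((m + 1 : ℕ) : ℝ)) ^ 2 := by positivity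
  have pGG : 0 ≤ C / (((m + 1 : ℕ) : ℝ)) ^ 2 * (C / (((m + 1 : ℕ) : ℝ)) ^ 2 * (1 + 2 / (δ₀ / (((m + 1 : ℕ) : ℝ))))) * 373248 := by positivity
  have pGGd : 0 ≤ C / (((m + 1 : ℕ) : ℝ)) ^ 2 * (C / (((m + 1 : ℕ) : ℝ)) ^ 2) * 373248 := by positivity
  refine ⟨hG0q, hG2q, fun x y => abs_Pgt_le_profile (m + 1) ha h40 h4P x y () (),
    fun x y μ => abs_Pgt_diff_right_le_profile (m + 1) ha h40 h4P x y μ () (), ?_, ?_, ?_, ?_, ?_, ?_, ?_, ?_⟩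
  · intro x y
    have h := weaken_letter hn pSG h42 (x - y) (cSG x y () ())
    refine h.trans (le_of_eq ?_); congr 1; field_simp
  · intro x y μ
    have h := weaken_letter hn pSGd h42 (x - y) (cSGd x y μ () ())
    refine h.trans (le_of_eq ?_); congr 1; field_simp
  · intro x y
    have h := weaken_letter hn pGS h42 (x - y) (cGS x y () ())
    refine h.trans (le_of_eq ?_); congr 1; field_simp
  · intro x y μ
    have h := weaken_letter hn pGSd h42 (x - y) (cGSd x y μ () ())
    refine h.trans (le_of_eq ?_); congr 1; field_simp
  · intro x y
    have h := cGSG x y () ()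
    refine h.trans (le_of_eq ?_); congr 1; field_simp
  · intro x y μ
    have h := cGSGd x y μ () ()
    refine h.trans (le_of_eq ?_); congr 1; field_simp
  · intro x y
    have h := weaken_letter hn pGG h42 (x - y) (cGG x y () ())
    refine h.trans ?_
    have hq := nrm_pos (x - y)
    refine mul_le_mul_of_nonneg_right (div_le_div_of_nonneg_right ?_ (by positivity)) (Real.exp_pos _).le
    -- `(C∕N²)·(C∕N²·(1 + 2∕(δ₀∕N)))·C₄ ≤ C·C·(1+2∕δ₀)·C₄∕N³`
    have e1 : C / (((m + 1 : ℕ) : ℝ)) ^ 2 * (C / (((m + 1 : ℕ) : ℝ)) ^ 2 * (1 + 2 / (δ₀ / (((m + 1 : ℕ) : ℝ))))) * 373248 = C * C * 373248 * ((1 + 2 * (((m + 1 : ℕ) : ℝ)) / δ₀) / (((m + 1 : ℕ) : ℝ)) ^ 4) := by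
      field_simp
    have e2 : C * C * (1 + 2 / δ₀) * 373248 / (((m + 1 : ℕ) : ℝ)) ^ 3 = C * C * 373248 * ((1 + 2 / δ₀) / (((m + 1 : ℕ) : ℝ)) ^ 3) := by ring
    rw [e1, e2]
    refine mul_le_mul_of_nonneg_left ?_ (by positivity)
    rw [div_le_div_iff₀ (by positivity) (by positivity)]
    have h3 : (((m + 1 : ℕ) : ℝ)) ^ 3 ≤ (((m + 1 : ℕ) : ℝ)) ^ 4 := pow_le_pow_right₀ hN (by norm_num)
    have e3 : (1 + 2 * (((m + 1 : ℕ) : ℝ)) / δ₀) * (((m + 1 : ℕ) : ℝ)) ^ 3 = (((m + 1 : ℕ) : ℝ)) ^ 3 + 2 / δ₀ * (((m + 1 : ℕ) : ℝ)) ^ 4 := by ring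
    have e4 : (1 + 2 / δ₀) * (((m + 1 : ℕ) : ℝ)) ^ 4 = (((m + 1 : ℕ) : ℝ)) ^ 4 + 2 / δ₀ * (((m + 1 : ℕ) : ℝ)) ^ 4 := by ring
    rw [e3, e4]; linarith
  · intro x y μ
    have h := weaken_letter hn pGGd h41 (x - y) (cGGd x y μ () ())
    refine h.trans (le_of_eq ?_); congr 1; field_simp

end Rows

end Summit.QuantumFields.BalabanUV.Beta.D1BFx.RestKernelGhostSharpLegs

end
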